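import Summits.SmoothPoincare4.SmoothPoincare4.Theses.ConvexBisection
import Literature.Topology.FourManifolds.ClosedBallProofs
import Literature.Geometry.Symplectic.SteinBall
import Literature.Geometry.Symplectic.SteinBallContact

/-!
# `ContractibleTwistedDoubleStandard` — negative-side support: doubles are Stein bisections

Support lemmas for the crux
`Summit.SmoothPoincare4.SmoothPoincare4.Theses.ConvexBisection.ContractibleTwistedDoubleStandard`
(stmt-SmoothPoincare4-3546), from the standing disprover's work file
`Cruxes/ContractibleTwistedDoubleStandard/Disproof.lean` (§3):

* (A1) `mfderiv_apply_mem_boundaryTangentSpace` — the differential of any `C¹` map from a boundaryless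
  3-manifold into `W` at a point sent to `∂W` takes values in the boundary hyperplane
  `T∂W = {v | v 0 = 0}` (Fermat on the normal coordinate of the boundary chart; no invariance of
  domain needed); (A2) `exists_mfderiv_incl_eq` — the boundary inclusion's differential maps
  ONTO `T∂W`; (A3) `map_mfderiv_eq_of_comp_incl_eq` — two smooth maps `W → P` agreeing along `∂W` map every
  subspace of `T∂W` (e.g. the complex tangencies `ξ`) to the same subspace.
* `steinBisection_of_glue` / `steinBisection_of_isDouble` — every double `D(W) = W ∪_id W` of a
  compact Stein domain, with the same Stein structure on both halves, satisfies the six hypotheses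
  of the crux; `crux_hypotheses_at_sphere` — so does `S⁴ = (Metric.closedBall (0 : EuclideanSpace ℝ (Fin 4)) 1) ∪ (Metric.closedBall (0 : EuclideanSpace ℝ (Fin 4)) 1)` with the standard Stein ball
  (NON-VACUITY of the crux, with contractible halves `contractibleSpace_closedBall_four`).
* `double_standard_of_crux` — hence the crux contains the `ψ = id` sector "doubles of contractible
  Stein domains are `S⁴`" (= standardness of all presentation homotopy spheres `Σ(𝒫, ε)` on paper):
  no refutation can come from `S⁴` itself, and any exotic presentation sphere kills the crux.
-/

noncomputable section

open scoped Manifold ContDiff Topology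
open Set Function Literature.Geometry.Symplectic Literature.Topology.FourManifolds

namespace Summit.SmoothPoincare4.SmoothPoincare4.Theorems.ContractibleTwistedDoubleStandard.Negative

open Summit.SmoothPoincare4.SmoothPoincare4.Theses.ConvexBisection

section Doubles

variable {W : Type*} [TopologicalSpace W] [ChartedSpace (EuclideanHalfSpace 4) W]

/-- **(A1) Maps into the boundary are tangent to it.** For a map `f` from a boundaryless
3-manifold into `W` and a point `z` with `f z ∈ ∂W`, every value `df_z u` lies in the boundary
hyperplane `{v | v 0 = 0}` of the preferred chart at `f z`. Proof: the normal coordinate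
`y ↦ (chart (f z) (f y)) 0` is `≥ 0` everywhere (the chart is valued in the half-space) and `= 0`
at `z` (boundary point), so `z` is a minimum and Fermat's theorem kills its derivative; if `f` is
not differentiable at `z` the junk value `mfderiv = 0` also lies in the hyperplane. [folklore] -/
theorem mfderiv_apply_mem_boundaryTangentSpace {N : Type*} [TopologicalSpace N]
    [ChartedSpace (EuclideanSpace ℝ (Fin 3)) N] (f : N → W) {z : N} (hz : f z ∈ (𝓡∂ 4).boundary W)
    (u : (EuclideanSpace ℝ (Fin 3))) :
    mfderiv (𝓡 3) (𝓡∂ 4) f z u ∈ boundaryTangentSpace := by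
  set D : (EuclideanSpace ℝ (Fin 3)) →L[ℝ] (EuclideanSpace ℝ (Fin 4)) := mfderiv (𝓡 3) (𝓡∂ 4) f z with hD
  show (D u) 0 = 0
  by_cases hf : MDifferentiableAt (𝓡 3) (𝓡∂ 4) f z
  swap
  · have h0 : D = 0 := mfderiv_zero_of_not_mdifferentiableAt hf
    rw [h0]; rfl
  set g : (EuclideanSpace ℝ (Fin 3)) → (EuclideanSpace ℝ (Fin 4)) := writtenInExtChartAt (𝓡 3) (𝓡∂ 4) z f with hg
  set y₀ : (EuclideanSpace ℝ (Fin 3)) := extChartAt (𝓡 3) z z with hy₀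
  set L : (EuclideanSpace ℝ (Fin 4)) →L[ℝ] ℝ := EuclideanSpace.proj (0 : Fin 4) with hL
  have hLv : ∀ v : (EuclideanSpace ℝ (Fin 4)), L v = v 0 := fun v => rfl
  have hr : range (𝓡 3) = (univ : Set (EuclideanSpace ℝ (Fin 3))) := by simp
  have hnonneg : ∀ y, 0 ≤ g y 0 := by
    intro y
    simp only [hg, writtenInExtChartAt, Function.comp_apply, extChartAt, OpenPartialHomeomorph.extend_coe]
    exact (chartAt (EuclideanHalfSpace 4) (f z) _).property
  have h0 : g y₀ 0 = 0 := by
    have hb := ModelWithCorners.isBoundaryPoint_iff.1 hz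
    rw [frontier_range_modelWithCornersEuclideanHalfSpace] at hb
    have : g y₀ = extChartAt (𝓡∂ 4) (f z) (f z) := by
      simp [hg, hy₀, writtenInExtChartAt]
    rw [this]
    exact (hb : (0 : ℝ) = _).symm
  have hmin : IsLocalMin (L ∘ g) y₀ :=
    Filter.Eventually.of_forall fun y => by
      show L (g y₀) ≤ L (g y)
      rw [hLv, hLv, h0]; exact hnonneg y
  have hd : DifferentiableAt ℝ g y₀ := by
    have := hf.differentiableWithinAt_writtenInExtChartAt
    rwa [hr, differentiableWithinAt_univ] at this
  have hd0 : HasFDerivAt (L ∘ g) (L.comp (fderiv ℝ g y₀)) y₀ :=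
    L.hasFDerivAt.comp y₀ hd.hasFDerivAt
  have hzero := hmin.hasFDerivAt_eq_zero hd0
  have key : (fderiv ℝ g y₀ u) 0 = 0 := by
    have := congrArg (fun T : (EuclideanSpace ℝ (Fin 3)) →L[ℝ] ℝ => T u) hzero
    simpa [hLv] using this
  have hm : D = fderiv ℝ g y₀ := by
    rw [hD, hf.mfderiv, hr, fderivWithin_univ]
  rw [hm]
  exact key

/-- The boundary hyperplane `T∂W = {v | v 0 = 0}` has dimension `3` (rank–nullity for the
coordinate functional). [folklore] -/
theorem finrank_boundaryTangentSpace :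
    Module.finrank ℝ (boundaryTangentSpace : Submodule ℝ (EuclideanSpace ℝ (Fin 4))) = 3 := by
  have h := LinearMap.finrank_range_add_finrank_ker
    ((EuclideanSpace.proj (0 : Fin 4) : (EuclideanSpace ℝ (Fin 4)) →L[ℝ] ℝ).toLinearMap)
  have hsurj : LinearMap.range ((EuclideanSpace.proj (0 : Fin 4) : (EuclideanSpace ℝ (Fin 4)) →L[ℝ] ℝ).toLinearMap) = ⊤ := by
    rw [LinearMap.range_eq_top]
    intro t
    exact ⟨EuclideanSpace.single 0 t, by simp⟩
  rw [hsurj, finrank_top, Module.finrank_self, finrank_euclideanSpace_fin] at h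
  change Module.finrank ℝ (LinearMap.ker ((EuclideanSpace.proj (0 : Fin 4) : (EuclideanSpace ℝ (Fin 4)) →L[ℝ] ℝ).toLinearMap)) = 3
  omega

variable [IsManifold (𝓡∂ 4) ∞ W]

/-- **(A2) The differential of the boundary inclusion maps ONTO the boundary hyperplane**: its
range lies in `T∂W` by (A1), it is injective (a smooth embedding is an immersion,
`Manifold.IsImmersionAt.mfderiv_injective`), and `dim T∂W = 3`; stated as: every boundary tangent
vector is the image of a vector tangent to the boundary manifold. [folklore] -/
theorem exists_mfderiv_incl_eq (b : BoundaryData (𝓡∂ 4) W (𝓡 3)) (z : b.carrier)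
    {v : (EuclideanSpace ℝ (Fin 4))} (hv : v ∈ boundaryTangentSpace) :
    ∃ u : (EuclideanSpace ℝ (Fin 3)), mfderiv (𝓡 3) (𝓡∂ 4) b.incl z u = v := by
  set D : (EuclideanSpace ℝ (Fin 3)) →L[ℝ] (EuclideanSpace ℝ (Fin 4)) := mfderiv (𝓡 3) (𝓡∂ 4) b.incl z with hD
  have hrange : LinearMap.range (D : (EuclideanSpace ℝ (Fin 3)) →ₗ[ℝ] (EuclideanSpace ℝ (Fin 4))) = boundaryTangentSpace := by
    refine Submodule.eq_of_le_of_finrank_eq (K := ℝ) (V := (EuclideanSpace ℝ (Fin 4))) ?_ ?_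
    · rintro v ⟨u, rfl⟩
      exact mfderiv_apply_mem_boundaryTangentSpace b.incl (b.incl_mem_boundary z) u
    · have hinj : Injective D :=
        Manifold.IsImmersionAt.mfderiv_injective
          (b.isSmoothEmbedding.isImmersion.isImmersionAt z) (by simp)
      have hinj' : Injective (D : (EuclideanSpace ℝ (Fin 3)) →ₗ[ℝ] (EuclideanSpace ℝ (Fin 4))) := hinj
      rw [LinearMap.finrank_range_of_inj hinj', finrank_euclideanSpace_fin,
        finrank_boundaryTangentSpace]
  rw [← hrange] at hv
  obtain ⟨u, rfl⟩ := hv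
  exact ⟨u, rfl⟩

/-- **(A3) Two smooth maps `W → P` that agree along `∂W` have equal differentials on `T∂W`**
(chain rule along the boundary inclusion + (A2)). [folklore] -/
theorem mfderiv_apply_eq_of_comp_incl_eq {P : Type*} [TopologicalSpace P]
    [ChartedSpace (EuclideanSpace ℝ (Fin 4)) P] (b : BoundaryData (𝓡∂ 4) W (𝓡 3))
    {jA jB : W → P} (hA : ContMDiff (𝓡∂ 4) (𝓡 4) ∞ jA) (hB : ContMDiff (𝓡∂ 4) (𝓡 4) ∞ jB)
    (h : jA ∘ b.incl = jB ∘ b.incl) (z : b.carrier) {v : (EuclideanSpace ℝ (Fin 4))}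
    (hv : v ∈ boundaryTangentSpace) :
    mfderiv (𝓡∂ 4) (𝓡 4) jA (b.incl z) v = mfderiv (𝓡∂ 4) (𝓡 4) jB (b.incl z) v := by
  obtain ⟨u, rfl⟩ := exists_mfderiv_incl_eq b z hv
  have hi : MDifferentiableAt (𝓡 3) (𝓡∂ 4) b.incl z :=
    b.isSmoothEmbedding.contMDiff.mdifferentiableAt (by simp)
  have eA := mfderiv_comp z (hA.mdifferentiableAt (by simp)) hi
  have eB := mfderiv_comp z (hB.mdifferentiableAt (by simp)) hi
  have hAB : mfderiv (𝓡 3) (𝓡 4) (jA ∘ b.incl) z = mfderiv (𝓡 3) (𝓡 4) (jB ∘ b.incl) z := by rw [h]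
  rw [eA, eB] at hAB
  have := congrArg (fun T => T u) hAB
  simp only [Function.comp_apply] at this
  exact this

/-- (A3), submodule form: the two differentials map every subspace of `T∂W` — in particular the
complex tangencies `ξ ≤ T∂W` — to the same subspace. [folklore] -/
theorem map_mfderiv_eq_of_comp_incl_eq {P : Type*} [TopologicalSpace P]
    [ChartedSpace (EuclideanSpace ℝ (Fin 4)) P] (b : BoundaryData (𝓡∂ 4) W (𝓡 3))
    {jA jB : W → P} (hA : ContMDiff (𝓡∂ 4) (𝓡 4) ∞ jA) (hB : ContMDiff (𝓡∂ 4) (𝓡 4) ∞ jB)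
    (h : jA ∘ b.incl = jB ∘ b.incl) (z : b.carrier) {S : Submodule ℝ (EuclideanSpace ℝ (Fin 4))}
    (hS : S ≤ boundaryTangentSpace) :
    Submodule.map (mfderiv (𝓡∂ 4) (𝓡 4) jA (b.incl z)).toLinearMap S =
      Submodule.map (mfderiv (𝓡∂ 4) (𝓡 4) jB (b.incl z)).toLinearMap S := by
  ext x
  simp only [Submodule.mem_map]
  constructor
  · rintro ⟨v, hv, rfl⟩
    exact ⟨v, hv, (mfderiv_apply_eq_of_comp_incl_eq b hA hB h z (hS hv)).symm⟩
  · rintro ⟨v, hv, rfl⟩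
    exact ⟨v, hv, mfderiv_apply_eq_of_comp_incl_eq b hA hB h z (hS hv)⟩

variable [CompactSpace W]

/-- **Gluing two copies of a Stein domain along the identity of the boundary gives a Stein
bisection along a common contact seam** — the six hypotheses of the crux
`ConvexBisection.ContractibleTwistedDoubleStandard` for `(P; W, W; S, S; jA, jB)`, stated as an
explicit conjunction (explicit form: `jA`, `jB` smooth embeddings covering `P` and meeting exactly
along `∂W`, pointwise identically). The contact-plane matching is (A3) applied to `ξ ≤ T∂W`; the
intersection conditions are bookkeeping with `b.range_incl`. [folklore] -/
theorem steinBisection_of_glue {P : Type*} [TopologicalSpace P] [ChartedSpace (EuclideanSpace ℝ (Fin 4)) P]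
    (b : BoundaryData (𝓡∂ 4) W (𝓡 3)) (S : SteinStructure W) {jA jB : W → P}
    (hA : Manifold.IsSmoothEmbedding (𝓡∂ 4) (𝓡 4) ∞ jA)
    (hB : Manifold.IsSmoothEmbedding (𝓡∂ 4) (𝓡 4) ∞ jB) (hU : range jA ∪ range jB = univ)
    (hR : ∀ a a', jA a = jB a' ↔ ∃ z, a = b.incl z ∧ a' = b.incl z) :
    Manifold.IsSmoothEmbedding (𝓡∂ 4) (𝓡 4) ∞ jA ∧ Manifold.IsSmoothEmbedding (𝓡∂ 4) (𝓡 4) ∞ jB ∧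
      range jA ∪ range jB = univ ∧ range jA ∩ range jB = jA '' (𝓡∂ 4).boundary W ∧
      range jA ∩ range jB = jB '' (𝓡∂ 4).boundary W ∧
      (∀ w₁ w₂, jA w₁ = jB w₂ →
        Submodule.map (mfderiv (𝓡∂ 4) (𝓡 4) jA w₁).toLinearMap (contactPlane S.J w₁) =
          Submodule.map (mfderiv (𝓡∂ 4) (𝓡 4) jB w₂).toLinearMap (contactPlane S.J w₂)) := by
  have hcomp : jA ∘ b.incl = jB ∘ b.incl := funext fun z => (hR _ _).2 ⟨z, rfl, rfl⟩
  refine ⟨hA, hB, hU, ?_, ?_, ?_⟩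
  · ext p
    constructor
    · rintro ⟨⟨a, rfl⟩, ⟨a', ha'⟩⟩
      obtain ⟨z, rfl, -⟩ := (hR a a').1 ha'.symm
      exact ⟨b.incl z, b.incl_mem_boundary z, rfl⟩
    · rintro ⟨a, ha, rfl⟩
      rw [← b.range_incl] at ha
      obtain ⟨z, rfl⟩ := ha
      exact ⟨mem_range_self _, ⟨b.incl z, ((hR _ _).2 ⟨z, rfl, rfl⟩).symm⟩⟩
  · ext p
    constructor
    · rintro ⟨⟨a, ha⟩, ⟨a', rfl⟩⟩
      obtain ⟨z, -, rfl⟩ := (hR a a').1 ha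
      exact ⟨b.incl z, b.incl_mem_boundary z, rfl⟩
    · rintro ⟨a, ha, rfl⟩
      rw [← b.range_incl] at ha
      obtain ⟨z, rfl⟩ := ha
      exact ⟨⟨b.incl z, (hR _ _).2 ⟨z, rfl, rfl⟩⟩, mem_range_self _⟩
  · intro w₁ w₂ hw
    obtain ⟨z, rfl, rfl⟩ := (hR w₁ w₂).1 hw
    exact map_mfderiv_eq_of_comp_incl_eq b hA.contMDiff hB.contMDiff hcomp z
      (contactPlane_le_boundaryTangentSpace S.J _)

/-- **Every double `D(W) = W ∪_id W` of a compact Stein domain is a Stein bisection along a common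
contact seam** (the six crux hypotheses), with the same Stein structure on both halves
(`Literature.Topology.FourManifolds.IsDouble` form). [folklore] -/
theorem steinBisection_of_isDouble {P : Type*} [TopologicalSpace P] [ChartedSpace (EuclideanSpace ℝ (Fin 4)) P]
    (b : BoundaryData (𝓡∂ 4) W (𝓡 3)) (S : SteinStructure W) (h : IsDouble b (𝓡 4) P) :
    ∃ jA jB : W → P,
      Manifold.IsSmoothEmbedding (𝓡∂ 4) (𝓡 4) ∞ jA ∧ Manifold.IsSmoothEmbedding (𝓡∂ 4) (𝓡 4) ∞ jB ∧
      range jA ∪ range jB = univ ∧ range jA ∩ range jB = jA '' (𝓡∂ 4).boundary W ∧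
      range jA ∩ range jB = jB '' (𝓡∂ 4).boundary W ∧
      (∀ w₁ w₂, jA w₁ = jB w₂ →
        Submodule.map (mfderiv (𝓡∂ 4) (𝓡 4) jA w₁).toLinearMap (contactPlane S.J w₁) =
          Submodule.map (mfderiv (𝓡∂ 4) (𝓡 4) jB w₂).toLinearMap (contactPlane S.J w₂)) := by
  obtain ⟨jA, jB, hA, hB, hU, hR⟩ := h
  exact ⟨jA, jB, steinBisection_of_glue b S hA hB hU hR⟩

end Doubles

section Sphere

/-- **NON-VACUITY: the round `S⁴` satisfies every hypothesis of the crux** — `S⁴ = (Metric.closedBall (0 : EuclideanSpace ℝ (Fin 4)) 1) ∪_id (Metric.closedBall (0 : EuclideanSpace ℝ (Fin 4)) 1)`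
(the tree's `isDouble_sphere_holds 3`: hemisphere embeddings by inverse stereographic projection)
with the standard Stein ball `steinStructureClosedBall` (`B⁴ ⊂ ℂ²`, `φ = |z|²`) on both halves is a
Stein bisection along the common contact seam `(S³, ξ_std)`. [folklore] -/
theorem crux_hypotheses_at_sphere : ∃ e₁ e₂ : (Metric.closedBall (0 : EuclideanSpace ℝ (Fin 4)) 1) → (Metric.sphere (0 : EuclideanSpace ℝ (Fin 5)) 1),
    Manifold.IsSmoothEmbedding (𝓡∂ 4) (𝓡 4) ∞ e₁ ∧ Manifold.IsSmoothEmbedding (𝓡∂ 4) (𝓡 4) ∞ e₂ ∧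
      range e₁ ∪ range e₂ = univ ∧ range e₁ ∩ range e₂ = e₁ '' (𝓡∂ 4).boundary (Metric.closedBall (0 : EuclideanSpace ℝ (Fin 4)) 1) ∧
      range e₁ ∩ range e₂ = e₂ '' (𝓡∂ 4).boundary (Metric.closedBall (0 : EuclideanSpace ℝ (Fin 4)) 1) ∧
      (∀ w₁ w₂, e₁ w₁ = e₂ w₂ →
        Submodule.map (mfderiv (𝓡∂ 4) (𝓡 4) e₁ w₁).toLinearMap
            (contactPlane steinStructureClosedBall.J w₁) =
          Submodule.map (mfderiv (𝓡∂ 4) (𝓡 4) e₂ w₂).toLinearMap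
            (contactPlane steinStructureClosedBall.J w₂)) :=
  steinBisection_of_isDouble (closedBallBoundaryData 3) steinStructureClosedBall
    (isDouble_sphere_holds (n := 3))

/-- The closed 4-ball is contractible (convex and nonempty) — so the sphere instance has
CONTRACTIBLE halves, as the crux demands. [folklore] -/
theorem contractibleSpace_closedBall_four : ContractibleSpace (Metric.closedBall (0 : EuclideanSpace ℝ (Fin 4)) 1) :=
  Convex.contractibleSpace (convex_closedBall _ _) ⟨0, Metric.mem_closedBall_self zero_le_one⟩

end Sphere

section SubCrux

/-- **The crux implies its `ψ = id` sector: doubles of contractible compact Stein domains are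
`S⁴`.** For a compact contractible `W` with a Stein structure and boundary datum `b`, every
(Hausdorff, second countable) double `P = W ∪_id W` is diffeomorphic to `S⁴`, GIVEN the crux
(doubles are Stein bisections, `steinBisection_of_isDouble`; compactness of `P` from the cover).
On paper `P = ∂(W × I)` is the presentation homotopy sphere `Σ(𝒫, ε)` of the balanced presentation
read off a Stein handle structure of `W`, and every `(𝒫, ε)` so arises; hence provers must at least
settle ALL presentation spheres (Akbulut–Kirby 1985, Gompf 1991, Meier–Zupan arXiv:1904.08527),
and a single exotic one refutes the crux. [folklore] -/
theorem double_standard_of_crux (h : ContractibleTwistedDoubleStandard)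
    (W : Type) [TopologicalSpace W] [ChartedSpace (EuclideanHalfSpace 4) W]
    [IsManifold (𝓡∂ 4) ∞ W] [CompactSpace W] [ContractibleSpace W]
    (S : SteinStructure W) (b : BoundaryData (𝓡∂ 4) W (𝓡 3))
    (P : Type) [TopologicalSpace P] [T2Space P] [SecondCountableTopology P]
    [ChartedSpace (EuclideanSpace ℝ (Fin 4)) P] [IsManifold (𝓡 4) ∞ P] (hD : IsDouble b (𝓡 4) P) :
    Nonempty (P ≃ₘ⟮𝓡 4, 𝓡 4⟯ (Metric.sphere (0 : EuclideanSpace ℝ (Fin 5)) 1)) := by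
  obtain ⟨jA, jB, hA, hB, hU, hL, hR', hC⟩ := steinBisection_of_isDouble b S hD
  haveI : CompactSpace P := ⟨by
    rw [← hU]
    exact (isCompact_range hA.isEmbedding.continuous).union
      (isCompact_range hB.isEmbedding.continuous)⟩
  exact h P W W S S jA jB hA hB hU hL hR' hC

end SubCrux

end Summit.SmoothPoincare4.SmoothPoincare4.Theorems.ContractibleTwistedDoubleStandard.Negative
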